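import Literature.MathematicalPhysics.QuantumFieldTheory.Balaban1983to89.T4AxialGaugeSmallField
import Literature.MathematicalPhysics.QuantumFieldTheory.Balaban1983to89.T4ReTrLipUnitary
import Literature.MathematicalPhysics.QuantumFieldTheory.Balaban1983to89.B15PrelimIntegrations
import Summits.QuantumFields.YangMills.Theorems.PoincareLipschitzHierAlignPotential
import HarnessLib

/-!
# `UnitScaleTiltTorusWrapHolonomies` — THE WHOLE-TORUS AXIAL GAUGE: OFF THE WRAP BONDS EVERYTHING IS SMALL, AND THE WRAP
# VARIABLES (THE CYCLE HOLONOMIES) ARE NEARLY CONSTANT ALONG THEIR TRANSVERSE TORUS AND NEARLY COMMUTE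
# (route `UnitScaleTilt`, crux K1′ `MinimiserStabilityRegPr` stmt-QuantumFields-19200, small-member exit (α)(a), piece P3 «`RegPr` ↦ toron gauge», FILE 1 of 3)

Cell `ym3-torus` (YM ladder rung R3 = continuum SU(2) Yang–Mills on T³ — a RUNG, NOT the Clay problem: not d = 4, not infinite volume,
not a mass gap); width seat `ym3-torus-px19` (gen 12); helper `--supports stmt-QuantumFields-19200`.  THEOREMS ONLY (0 `def`, 0 `sorry`, default
heartbeats), for ANY `[GaugeGroup G]`, any dimension `P.d` and any lattice level `j`.

WHY (LOCATE-SMALL-MEMBERS §(iv)(α) ∕ LOCATE-(α)(a)-2 §4 of `ym3-torus-px10` g10; ★★OWNER WORD 79 (a) «(4) member ↦ nearest toron», WORD 82 (ii) «P3 small-torus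
`RegPr ↦ toron` gauge»).  For the finitely many SMALL members `(m, n)` of a block size `L` the twisted-Plancherel certificate is written at an EXACT toron
(constant abelian background); a `RegPr` member `U₀` (all plaquettes `< ε₀L^{−2(K−n)}` on the finest torus, `2L^{m+K}` sites per direction) must be moved
there by a GLOBAL gauge.  The tree's ✓`T4AxialGaugeSmallField` (pub-balaban pv26) already supplies the axial gauge of any NON-WRAPPING box with the
non-abelian Poincaré lemma `dist1 (U^{ax} b) ≤ (d−1)·n·δ`; taking the box `[0, N−1]^d` (`N = sitesPerDir j`) this covers every bond EXCEPT the `d·N^{d−1}`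
WRAP bonds `⟨x, μ⟩` with `x_μ = N − 1 = −1`, which carry the cycle holonomies and cannot be small (✓`B15Prop1HolonomyObstruction`).  This file adds the two
rows the toron gauge needs about them, for an arbitrary bond field `V` that is `δ`-flat (`PlaqSmall δ V`) and `a`-small off the wrap bonds:

* §3 ★`dist1_parallel_step` — two parallel `μ`-bonds one transverse step apart differ by `≤ δ + 2a` (`dist1 (V⟨x+e_κ, μ⟩·V⟨x, μ⟩⁻¹)`), whenever the two
  rungs `⟨x, κ⟩`, `⟨x+e_μ, κ⟩` of the plaquette between them are non-wrap (`x_κ ≠ −1`) — wrap or not in direction `μ`;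
* §4 ★`dist1_parallel_walk` ∕ ★★`dist1_parallel_toBase` ∕ ★★`dist1_parallel` — hence ALL parallel `μ`-bonds with the same `μ`-coordinate (in particular all
  wrap variables of direction `μ`) are pairwise `2(d−1)(N−1)(δ+2a)`-close (walks that raise one transverse coordinate at a time from `0`, never crossing a wrap);
* §5 ★★★`dist1_commutator_wrap` — two wrap variables of different directions `μ < κ` issuing from a common corner NEARLY COMMUTE:
  `dist1 (h_μ h_κ h_μ⁻¹ h_κ⁻¹) ≤ δ + 2(N−1)(δ+2a)` (the corner plaquette at `x_μ = x_κ = −1` reads `w₁ h_κ h_μ⁻¹ w₂⁻¹` with `w₁ ≈ h_μ`, `w₂ ≈ h_κ` by §4);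
* §6 ★★★`exists_gauge_wrap_rows` — instantiated at `V := U^{axialGauge U 0 (N−1)}`, `a := (d−1)(N−1)δ` (✓`dist1_gaugeAct_axialGauge_le_of_mem_boxBonds` BY NAME,
  through the dictionary `mem_boxBonds_of_ne_neg_one`): for every `δ`-flat `U` there is a gauge in which every non-wrap bond is `(d−1)(N−1)δ`-near `1`, parallel
  wrap variables are `2(d−1)(N−1)(δ + 2(d−1)(N−1)δ)`-close and corner holonomies `δ + 2(N−1)(δ + 2(d−1)(N−1)δ)`-commute — all `O(N²δ)`.

K-UNIFORMITY (the point for (α)(a)).  For the member `(F, n, K)`: `N = 2L^{m+K}`, `δ = ε₀L^{−2(K−n)}` ⇒ `N²δ = 4ε₀L^{2(m+n)}` — no `K`.  FILES 2–3 (SU(2) near-commuting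
triples ↦ a common maximal torus; the abelian spreading gauge) turn these rows into «`U^σ` is `O((N²δ)^{1∕3})`-near a toron, the defect sitting on the wrap bonds».
HONEST SCOPE.  Lattice-gauge bookkeeping over the tree's axial gauge; nothing of (α)(a)'s coercivity, `hT`, `hGF`, EX, `MinimiserStabilityRegPr` (19200) or the rung
`YM3TorusSU2` is proved; no summit statement is proved; the Yang–Mills mass gap is NOT proved.
References: [Balaban1985Averaging] (8)–(9) p. 19 (gauge action, plaquette variables), p. 24 (axial gauge contours); [Balaban1985UV3] (12)–(13) p. 258–259.
-/

set_option autoImplicit false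

open Literature.MathematicalPhysics.QuantumFieldTheory.Balaban1983to89
open Literature.MathematicalPhysics.QuantumFieldTheory.Balaban1983to89.T4AxialGaugeSmallField (castSite castSite_apply boxBonds boxPlaqs axialGauge
  dist1_gaugeAct_axialGauge_le_of_mem_boxBonds)
open Literature.MathematicalPhysics.QuantumFieldTheory.Balaban1983to89.T4ReTrLipUnitary (plaqSmall_gaugeAct_iff)
open Literature.MathematicalPhysics.QuantumFieldTheory.Balaban1983to89.B7Prop1Explicit (e e_apply)
open Literature.MathematicalPhysics.QuantumFieldTheory.Balaban1983to89.B15.PrelimIntegrations (dist1_fluct_le)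
open Summit.QuantumFields.YangMills.Theorems.PoincareLipschitzHierAlignPotential (dist1_mul_mul_le)
open scoped BigOperators

namespace Summit.QuantumFields.YangMills.Theorems.TorusWrapHolonomies

variable {P : Params} {j : ℕ} {G : Type*} [GaugeGroup G]

/-! ## §1 Group bookkeeping is REUSED BY NAME: `dist1_mul_mul_le` (✓`PoincareLipschitzHierAlignPotential`), the right-invariant triangle inequality
`dist1_fluct_le` (✓`B15.PrelimIntegrations`); `dist1` is the conjugation-invariant length of `Setup.GaugeGroup`. -/

/-! ## §2 Torus coordinates: the wrap coordinate `N − 1 = −1`, steps, updates -/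

/-- `N − 1 = −1` in `ℤ∕N`, `N = sitesPerDir j`. [folklore] -/
theorem natCast_pred_sitesPerDir : (((P.sitesPerDir j - 1 : ℕ)) : ZMod (P.sitesPerDir j)) = -1 := by
  have h1 : 1 ≤ P.sitesPerDir j := Nat.one_le_iff_ne_zero.mpr (P.sitesPerDir_ne_zero j)
  rw [Nat.cast_sub h1, ZMod.natCast_self, Nat.cast_one, zero_sub]

/-- A coordinate value `t` with `t + 1 < N` is not the wrap coordinate `−1`. [folklore] -/
theorem natCast_ne_neg_one_of_succ_lt {t : ℕ} (ht : t + 1 < P.sitesPerDir j) : ((t : ℕ) : ZMod (P.sitesPerDir j)) ≠ -1 := by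
  intro h
  have h0 : ((t + 1 : ℕ) : ZMod (P.sitesPerDir j)) = 0 := by push_cast; rw [h]; ring
  rw [ZMod.natCast_eq_zero_iff] at h0
  exact absurd (Nat.le_of_dvd (Nat.succ_pos t) h0) (not_le.mpr ht)

/-- Stepping the updated coordinate: `(x[κ ↦ c]) + e_κ = x[κ ↦ c + 1]`. [folklore] -/
theorem shift_update_self (x : Site P j) (κ : Fin P.d) (c : ZMod (P.sitesPerDir j)) :
    Site.shift (Function.update x κ c) κ = Function.update x κ (c + 1) := by
  simp [Site.shift]

/-- A step commutes with an update of a different coordinate. [folklore] -/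
theorem shift_update_of_ne (x : Site P j) {μ κ : Fin P.d} (h : κ ≠ μ) (c : ZMod (P.sitesPerDir j)) :
    Site.shift (Function.update x κ c) μ = Function.update (x.shift μ) κ c := by
  simp only [Site.shift, Function.update_of_ne (Ne.symm h)]
  exact Function.update_comm h _ _ _

/-! ## §3 One transverse step between parallel bonds -/

/-- ★ **PARALLEL BONDS ONE TRANSVERSE STEP APART ARE CLOSE.**  `V` `δ`-flat and `a`-small on the non-wrap bonds (`b.src b.dir ≠ −1`); `κ ≠ μ`;
the two `κ`-rungs of the plaquette through `⟨x, μ⟩` and `⟨x+e_κ, μ⟩` non-wrap (`x_κ ≠ −1`).  Then `dist1 (V⟨x+e_κ, μ⟩ · V⟨x, μ⟩⁻¹) ≤ δ + 2a`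
— whether or not the two `μ`-bonds themselves wrap.  (`W′W⁻¹ = A⁻¹·(A W′ B⁻¹ W⁻¹)·(W B W⁻¹)` for `κ < μ`, the inverse plaquette for `μ < κ`.)
[cite: Balaban1985Averaging, (9) p.19] -/
theorem dist1_parallel_step {V : GaugeField P j G} {δ a : ℝ} (hV : PlaqSmall δ V)
    (hax : ∀ b : PBond P j, b.src b.dir ≠ -1 → dist1 (V b) ≤ a)
    {μ κ : Fin P.d} (hκμ : κ ≠ μ) (x : Site P j) (hxκ : x κ ≠ -1) :
    dist1 (V ⟨x.shift κ, μ⟩ * (V ⟨x, μ⟩)⁻¹) ≤ δ + 2 * a := by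
  have hA : dist1 (V ⟨x, κ⟩) ≤ a := hax ⟨x, κ⟩ hxκ
  have hB : dist1 (V ⟨x.shift μ, κ⟩) ≤ a :=
    hax ⟨x.shift μ, κ⟩ (show (x.shift μ) κ ≠ -1 by simp only [Site.shift, Function.update_of_ne hκμ]; exact hxκ)
  rcases lt_or_gt_of_ne hκμ with h | h
  · -- `κ < μ`: the plaquette `⟨x; κ, μ⟩` reads `A · W′ · B⁻¹ · W⁻¹`
    have hp := (hV ⟨x, κ, μ, h⟩).le
    simp only [GaugeField.plaqHol] at hp
    have key : V ⟨x.shift κ, μ⟩ * (V ⟨x, μ⟩)⁻¹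
        = (V ⟨x, κ⟩)⁻¹ * (V ⟨x, κ⟩ * V ⟨x.shift κ, μ⟩ * (V ⟨x.shift μ, κ⟩)⁻¹ * (V ⟨x, μ⟩)⁻¹)
            * (V ⟨x, μ⟩ * V ⟨x.shift μ, κ⟩ * (V ⟨x, μ⟩)⁻¹) := by group
    rw [key]
    refine (dist1_mul_mul_le _ _ _).trans ?_
    rw [GaugeGroup.dist1_inv, GaugeGroup.dist1_conj]
    linarith
  · -- `μ < κ`: the plaquette `⟨x; μ, κ⟩` reads `W · B · W′⁻¹ · A⁻¹`
    have hp := (hV ⟨x, μ, κ, h⟩).le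
    simp only [GaugeField.plaqHol] at hp
    have key : V ⟨x.shift κ, μ⟩ * (V ⟨x, μ⟩)⁻¹
        = (V ⟨x, κ⟩)⁻¹ * (V ⟨x, μ⟩ * V ⟨x.shift μ, κ⟩ * (V ⟨x.shift κ, μ⟩)⁻¹ * (V ⟨x, κ⟩)⁻¹)⁻¹
            * (V ⟨x, μ⟩ * V ⟨x.shift μ, κ⟩ * (V ⟨x, μ⟩)⁻¹) := by group
    rw [key]
    refine (dist1_mul_mul_le _ _ _).trans ?_
    rw [GaugeGroup.dist1_inv, GaugeGroup.dist1_inv, GaugeGroup.dist1_conj]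
    linarith

/-! ## §4 Walks: all parallel bonds with the same longitudinal coordinate are close -/

/-- ★ **RAISING ONE TRANSVERSE COORDINATE FROM `0` TO `t < N`** costs `t·(δ + 2a)`: `dist1 (V⟨x[κ ↦ t], μ⟩ · V⟨x[κ ↦ 0], μ⟩⁻¹) ≤ t(δ+2a)` — the walk
`0, 1, …, t` never stands on the wrap coordinate `−1 = N − 1` before its last step. [cite: Balaban1985Averaging, (9) p.19] -/
theorem dist1_parallel_walk {V : GaugeField P j G} {δ a : ℝ} (hV : PlaqSmall δ V)
    (hax : ∀ b : PBond P j, b.src b.dir ≠ -1 → dist1 (V b) ≤ a)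
    {μ κ : Fin P.d} (hκμ : κ ≠ μ) (x : Site P j) :
    ∀ t : ℕ, t < P.sitesPerDir j →
      dist1 (V ⟨Function.update x κ (t : ZMod (P.sitesPerDir j)), μ⟩ * (V ⟨Function.update x κ 0, μ⟩)⁻¹) ≤ t * (δ + 2 * a)
  | 0, _ => by simp [GaugeGroup.dist1_one]
  | t + 1, ht => by
    have ih := dist1_parallel_walk hV hax hκμ x t (Nat.lt_of_succ_lt ht)
    have hyκ : (Function.update x κ (t : ZMod (P.sitesPerDir j)) : Site P j) κ ≠ -1 := by
      rw [Function.update_self]; exact natCast_ne_neg_one_of_succ_lt ht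
    have hstep := dist1_parallel_step hV hax hκμ (Function.update x κ (t : ZMod (P.sitesPerDir j))) hyκ
    rw [show Site.shift (Function.update x κ (t : ZMod (P.sitesPerDir j))) κ = Function.update x κ ((t : ZMod (P.sitesPerDir j)) + 1)
      from shift_update_self x κ _] at hstep
    have hcast : ((t : ℕ) : ZMod (P.sitesPerDir j)) + 1 = ((t + 1 : ℕ) : ZMod (P.sitesPerDir j)) := by push_cast; ring
    rw [hcast] at hstep
    calc dist1 (V ⟨Function.update x κ ((t + 1 : ℕ) : ZMod (P.sitesPerDir j)), μ⟩ * (V ⟨Function.update x κ 0, μ⟩)⁻¹)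
        ≤ dist1 (V ⟨Function.update x κ ((t + 1 : ℕ) : ZMod (P.sitesPerDir j)), μ⟩ * (V ⟨Function.update x κ (t : ZMod (P.sitesPerDir j)), μ⟩)⁻¹)
          + dist1 (V ⟨Function.update x κ (t : ZMod (P.sitesPerDir j)), μ⟩ * (V ⟨Function.update x κ 0, μ⟩)⁻¹) := dist1_fluct_le _ _ _
      _ ≤ (δ + 2 * a) + t * (δ + 2 * a) := add_le_add hstep ih
      _ = ((t + 1 : ℕ) : ℝ) * (δ + 2 * a) := by push_cast; ring

/-- ★★ **RAISING THE TRANSVERSE COORDINATES OF A SET `S ∌ μ` FROM `0` TO THEIR VALUES IN `x`** costs `(Σ_{κ∈S} x_κ)·(δ + 2a)` (one coordinate at a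
time, `Finset` induction over `dist1_parallel_walk`; the base point keeps the longitudinal coordinate `x_μ` and has all other coordinates `0`).
[cite: Balaban1985Averaging, (9) p.19] -/
theorem dist1_parallel_piecewise {V : GaugeField P j G} {δ a : ℝ} (hV : PlaqSmall δ V)
    (hax : ∀ b : PBond P j, b.src b.dir ≠ -1 → dist1 (V b) ≤ a) {μ : Fin P.d} (x : Site P j)
    (S : Finset (Fin P.d)) (hS : μ ∉ S) :
    dist1 (V ⟨S.piecewise x (Function.update (fun _ => (0 : ZMod (P.sitesPerDir j))) μ (x μ)), μ⟩
        * (V ⟨Function.update (fun _ => (0 : ZMod (P.sitesPerDir j))) μ (x μ), μ⟩)⁻¹)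
      ≤ (∑ κ ∈ S, ((x κ).val : ℝ)) * (δ + 2 * a) := by
  induction S using Finset.induction_on with
  | empty => simp [GaugeGroup.dist1_one]
  | insert κ S hκS ih =>
    have hκμ : κ ≠ μ := fun h => hS (h ▸ Finset.mem_insert_self κ S)
    have hμS : μ ∉ S := fun h => hS (Finset.mem_insert_of_mem h)
    rw [Finset.piecewise_insert, Finset.sum_insert hκS]
    set x₀ : Site P j := Function.update (fun _ => (0 : ZMod (P.sitesPerDir j))) μ (x μ) with hx₀
    set z : Site P j := S.piecewise x x₀ with hz
    have hzκ : z κ = 0 := by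
      rw [hz, Finset.piecewise_eq_of_notMem _ _ _ hκS, hx₀, Function.update_of_ne hκμ]
    have hwalk := dist1_parallel_walk hV hax hκμ z (x κ).val (ZMod.val_lt _)
    rw [ZMod.natCast_zmod_val, show Function.update z κ (0 : ZMod (P.sitesPerDir j)) = z by
      rw [← hzκ, Function.update_eq_self]] at hwalk
    calc dist1 (V ⟨Function.update z κ (x κ), μ⟩ * (V ⟨x₀, μ⟩)⁻¹)
        ≤ dist1 (V ⟨Function.update z κ (x κ), μ⟩ * (V ⟨z, μ⟩)⁻¹) + dist1 (V ⟨z, μ⟩ * (V ⟨x₀, μ⟩)⁻¹) :=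
          dist1_fluct_le _ _ _
      _ ≤ ((x κ).val : ℝ) * (δ + 2 * a) + (∑ κ' ∈ S, ((x κ').val : ℝ)) * (δ + 2 * a) := add_le_add hwalk (ih hμS)
      _ = (((x κ).val : ℝ) + ∑ κ' ∈ S, ((x κ').val : ℝ)) * (δ + 2 * a) := by ring

/-- ★★ **EVERY `μ`-BOND IS CLOSE TO THE BASE `μ`-BOND OF ITS LONGITUDINAL COORDINATE**: `dist1 (V⟨x, μ⟩ · V⟨x₀, μ⟩⁻¹) ≤ (d−1)(N−1)(δ + 2a)` with
`x₀ = (0, …, x_μ, …, 0)` (`δ, a ≥ 0`; each transverse coordinate costs at most `N − 1` steps). [cite: Balaban1985Averaging, (9) p.19] -/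
theorem dist1_parallel_toBase {V : GaugeField P j G} {δ a : ℝ} (hV : PlaqSmall δ V)
    (hax : ∀ b : PBond P j, b.src b.dir ≠ -1 → dist1 (V b) ≤ a) (hδ : 0 ≤ δ) (ha : 0 ≤ a) (μ : Fin P.d) (x : Site P j) :
    dist1 (V ⟨x, μ⟩ * (V ⟨Function.update (fun _ => (0 : ZMod (P.sitesPerDir j))) μ (x μ), μ⟩)⁻¹)
      ≤ ((P.d - 1 : ℕ) : ℝ) * ((P.sitesPerDir j - 1 : ℕ) : ℝ) * (δ + 2 * a) := by
  have hμ : μ ∉ (Finset.univ : Finset (Fin P.d)).erase μ := Finset.notMem_erase μ _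
  have h := dist1_parallel_piecewise hV hax x ((Finset.univ : Finset (Fin P.d)).erase μ) hμ
  have hpw : ((Finset.univ : Finset (Fin P.d)).erase μ).piecewise x
      (Function.update (fun _ => (0 : ZMod (P.sitesPerDir j))) μ (x μ)) = x := by
    funext κ
    by_cases hκ : κ = μ
    · subst hκ
      rw [Finset.piecewise_eq_of_notMem _ _ _ hμ, Function.update_self]
    · exact Finset.piecewise_eq_of_mem _ _ _ (Finset.mem_erase.mpr ⟨hκ, Finset.mem_univ κ⟩)
  rw [hpw] at h
  refine h.trans (mul_le_mul_of_nonneg_right ?_ (by linarith))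
  have hsum : ∑ κ ∈ (Finset.univ : Finset (Fin P.d)).erase μ, ((x κ).val : ℝ)
      ≤ (((Finset.univ : Finset (Fin P.d)).erase μ).card : ℝ) * ((P.sitesPerDir j - 1 : ℕ) : ℝ) := by
    rw [← nsmul_eq_mul]
    refine Finset.sum_le_card_nsmul _ _ _ fun κ _ => ?_
    exact_mod_cast Nat.le_sub_one_of_lt (ZMod.val_lt (x κ))
  rwa [Finset.card_erase_of_mem (Finset.mem_univ μ), Finset.card_univ, Fintype.card_fin] at hsum

/-- ★★ **PARALLEL BONDS WITH THE SAME LONGITUDINAL COORDINATE ARE PAIRWISE CLOSE** — in particular all WRAP variables of one direction (`x_μ = y_μ = −1`):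
`dist1 (V⟨x, μ⟩ · V⟨y, μ⟩⁻¹) ≤ 2(d−1)(N−1)(δ + 2a)`. [cite: Balaban1985Averaging, (9) p.19] -/
theorem dist1_parallel {V : GaugeField P j G} {δ a : ℝ} (hV : PlaqSmall δ V)
    (hax : ∀ b : PBond P j, b.src b.dir ≠ -1 → dist1 (V b) ≤ a) (hδ : 0 ≤ δ) (ha : 0 ≤ a) (μ : Fin P.d) (x y : Site P j)
    (hxy : x μ = y μ) :
    dist1 (V ⟨x, μ⟩ * (V ⟨y, μ⟩)⁻¹) ≤ 2 * (((P.d - 1 : ℕ) : ℝ) * ((P.sitesPerDir j - 1 : ℕ) : ℝ) * (δ + 2 * a)) := by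
  have hx := dist1_parallel_toBase hV hax hδ ha μ x
  have hy := dist1_parallel_toBase hV hax hδ ha μ y
  rw [hxy] at hx
  rw [← GaugeGroup.dist1_inv, mul_inv_rev, inv_inv] at hy
  linarith [dist1_fluct_le (V ⟨x, μ⟩) (V ⟨Function.update (fun _ => (0 : ZMod (P.sitesPerDir j))) μ (y μ), μ⟩) (V ⟨y, μ⟩)]

/-! ## §5 The corner plaquette: wrap variables of different directions nearly commute -/

/-- ★★★ **CYCLE HOLONOMIES NEARLY COMMUTE.**  For `μ < κ` and a corner `z` (`z_μ = z_κ = 0`) let `h_μ := V⟨z[μ ↦ −1], μ⟩`, `h_κ := V⟨z[κ ↦ −1], κ⟩` be the two wrap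
variables issuing towards the corner.  Then `dist1 (h_μ h_κ h_μ⁻¹ h_κ⁻¹) ≤ δ + 2(N−1)(δ + 2a)`: the plaquette at `x = z[μ ↦ −1][κ ↦ −1]` reads `w₁ h_κ h_μ⁻¹ w₂⁻¹`
with `w₁ = V⟨x, μ⟩`, `w₂ = V⟨x, κ⟩` each `(N−1)(δ+2a)`-close to `h_μ`, `h_κ` (§4, ONE transverse coordinate raised from `0` to `N − 1`), and
`h_μ h_κ h_μ⁻¹ h_κ⁻¹ = (h_μ w₁⁻¹)·(w₁ h_κ h_μ⁻¹ w₂⁻¹)·(w₂ h_κ⁻¹)`. [cite: Balaban1985Averaging, (9) p.19] -/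
theorem dist1_commutator_wrap {V : GaugeField P j G} {δ a : ℝ} (hV : PlaqSmall δ V)
    (hax : ∀ b : PBond P j, b.src b.dir ≠ -1 → dist1 (V b) ≤ a) {μ κ : Fin P.d} (hμκ : μ < κ) (z : Site P j)
    (hzμ : z μ = 0) (hzκ : z κ = 0) :
    dist1 (V ⟨Function.update z μ (-1), μ⟩ * V ⟨Function.update z κ (-1), κ⟩
        * (V ⟨Function.update z μ (-1), μ⟩)⁻¹ * (V ⟨Function.update z κ (-1), κ⟩)⁻¹)
      ≤ δ + 2 * (((P.sitesPerDir j - 1 : ℕ) : ℝ) * (δ + 2 * a)) := by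
  have hne : μ ≠ κ := ne_of_lt hμκ
  have hN : (P.sitesPerDir j - 1 : ℕ) < P.sitesPerDir j := Nat.sub_one_lt (P.sitesPerDir_ne_zero j)
  -- the corner site and its two steps
  set x : Site P j := Function.update (Function.update z μ (-1)) κ (-1) with hx
  have hxμ : x.shift μ = Function.update z κ (-1) := by
    rw [hx, shift_update_of_ne _ (Ne.symm hne), shift_update_self, neg_add_cancel, ← hzμ, Function.update_eq_self]
  have hxκ : x.shift κ = Function.update z μ (-1) := by
    rw [hx, shift_update_self, neg_add_cancel]
    have h0 : (Function.update z μ (-1) : Site P j) κ = 0 := by rw [Function.update_of_ne (Ne.symm hne)]; exact hzκ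
    rw [← h0, Function.update_eq_self]
  -- the corner plaquette `⟨x; μ, κ⟩ = w₁ h_κ h_μ⁻¹ w₂⁻¹`
  have hp := (hV ⟨x, μ, κ, hμκ⟩).le
  simp only [GaugeField.plaqHol] at hp
  rw [hxμ, hxκ] at hp
  -- `w₁ ≈ h_μ`: raise the coordinate `κ` of `x + e_κ = z[μ ↦ −1]` from `0` to `N − 1`
  have h₁ := dist1_parallel_walk hV hax (Ne.symm hne) (Function.update z μ (-1)) (P.sitesPerDir j - 1) hN
  have h₂ := dist1_parallel_walk hV hax hne (Function.update z κ (-1)) (P.sitesPerDir j - 1) hN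
  rw [natCast_pred_sitesPerDir] at h₁ h₂
  have e₁ : Function.update (Function.update z μ (-1)) κ (0 : ZMod (P.sitesPerDir j)) = Function.update z μ (-1) := by
    have h0 : (Function.update z μ (-1) : Site P j) κ = 0 := by rw [Function.update_of_ne (Ne.symm hne)]; exact hzκ
    rw [← h0, Function.update_eq_self]
  have e₂ : Function.update (Function.update z κ (-1)) μ (0 : ZMod (P.sitesPerDir j)) = Function.update z κ (-1) := by
    have h0 : (Function.update z κ (-1) : Site P j) μ = 0 := by rw [Function.update_of_ne hne]; exact hzμ
    rw [← h0, Function.update_eq_self]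
  have e₃ : Function.update (Function.update z κ (-1)) μ (-1 : ZMod (P.sitesPerDir j)) = x := by
    rw [hx]; exact Function.update_comm (Ne.symm hne) _ _ _
  rw [e₁, ← hx] at h₁
  rw [e₂, e₃] at h₂
  -- assemble
  have key : V ⟨Function.update z μ (-1), μ⟩ * V ⟨Function.update z κ (-1), κ⟩
        * (V ⟨Function.update z μ (-1), μ⟩)⁻¹ * (V ⟨Function.update z κ (-1), κ⟩)⁻¹
      = (V ⟨x, μ⟩ * (V ⟨Function.update z μ (-1), μ⟩)⁻¹)⁻¹
        * (V ⟨x, μ⟩ * V ⟨Function.update z κ (-1), κ⟩ * (V ⟨Function.update z μ (-1), μ⟩)⁻¹ * (V ⟨x, κ⟩)⁻¹)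
        * (V ⟨x, κ⟩ * (V ⟨Function.update z κ (-1), κ⟩)⁻¹) := by group
  rw [key]
  refine (dist1_mul_mul_le _ _ _).trans ?_
  rw [GaugeGroup.dist1_inv]
  linarith

/-! ## §6 The axial gauge of the whole torus `[0, N−1]^d`: the rows instantiated (✓`T4AxialGaugeSmallField` BY NAME) -/

/-- DICTIONARY: a bond whose longitudinal coordinate is not the wrap coordinate `−1 = N − 1` is a bond of the box `[0, N−1]^d` in the sense of
✓`T4AxialGaugeSmallField.boxBonds` (integer representatives `x_κ = (b.src κ).val`). [folklore] -/
theorem mem_boxBonds_of_ne_neg_one (b : PBond P j) (hb : b.src b.dir ≠ -1) :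
    b ∈ boxBonds (0 : Fin P.d → ℤ) (fun _ => (P.sitesPerDir j : ℤ) - 1) := by
  refine ⟨fun κ => ((b.src κ).val : ℤ), fun κ => Int.natCast_nonneg _, fun κ => ?_, ?_⟩
  · simp only [Pi.add_apply, e_apply]
    have hlt : (b.src κ).val < P.sitesPerDir j := ZMod.val_lt _
    split_ifs with h
    · subst h
      have hne : (b.src b.dir).val ≠ P.sitesPerDir j - 1 := by
        intro hv
        apply hb
        rw [← ZMod.natCast_zmod_val (b.src b.dir), hv, natCast_pred_sitesPerDir]
      omega
    · omega
  · funext κ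
    simp [castSite_apply]

/-- ★★★ **THE WHOLE-TORUS AXIAL GAUGE AND ITS WRAP ROWS.**  For every `δ`-flat configuration `U` on `T^{(j)}` (`PlaqSmall δ U`, `0 ≤ δ`; any `[GaugeGroup G]`,
any `d`) there is a gauge `σ` (the axial gauge of the box `[0, N−1]^d`, `N = sitesPerDir j`, ✓`T4AxialGaugeSmallField.axialGauge`) such that, with `A := (d−1)(N−1)δ`:
(o) `U^σ` is `δ`-flat; (i) every NON-WRAP bond (`x_μ ≠ −1`) has `dist1 (U^σ b) ≤ A` (✓`dist1_gaugeAct_axialGauge_le_of_mem_boxBonds`); (ii) any two parallel bonds with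
the same longitudinal coordinate — in particular any two WRAP variables of one direction — satisfy `dist1 (U^σ⟨x,μ⟩ · U^σ⟨y,μ⟩⁻¹) ≤ 2(d−1)(N−1)(δ + 2A)`;
(iii) the wrap variables of two directions `μ < κ` at any corner `z` (`z_μ = z_κ = 0`) satisfy `dist1 (h_μ h_κ h_μ⁻¹ h_κ⁻¹) ≤ δ + 2(N−1)(δ + 2A)`.
All bounds are `O(d²N²δ)`; for the (α)(a) member `(F, n, K)` (`N = 2L^{m+K}`, `δ = ε₀L^{−2(K−n)}`) they are `O(ε₀L^{2(m+n)})`, uniformly in `K`.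
[cite: Balaban1985Averaging, (8)-(9) p.19, p.24] -/
theorem exists_gauge_wrap_rows (U : GaugeField P j G) {δ : ℝ} (hδ : 0 ≤ δ) (hU : PlaqSmall δ U) :
    ∃ σ : GaugeTransf P j G,
      PlaqSmall δ (GaugeField.gaugeAct σ U) ∧
      (∀ b : PBond P j, b.src b.dir ≠ -1 →
        dist1 (GaugeField.gaugeAct σ U b) ≤ ((P.d - 1 : ℕ) : ℝ) * ((P.sitesPerDir j - 1 : ℕ) : ℝ) * δ) ∧
      (∀ (μ : Fin P.d) (x y : Site P j), x μ = y μ →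
        dist1 (GaugeField.gaugeAct σ U ⟨x, μ⟩ * (GaugeField.gaugeAct σ U ⟨y, μ⟩)⁻¹)
          ≤ 2 * (((P.d - 1 : ℕ) : ℝ) * ((P.sitesPerDir j - 1 : ℕ) : ℝ)
              * (δ + 2 * (((P.d - 1 : ℕ) : ℝ) * ((P.sitesPerDir j - 1 : ℕ) : ℝ) * δ)))) ∧
      (∀ (μ κ : Fin P.d), μ < κ → ∀ z : Site P j, z μ = 0 → z κ = 0 →
        dist1 (GaugeField.gaugeAct σ U ⟨Function.update z μ (-1), μ⟩ * GaugeField.gaugeAct σ U ⟨Function.update z κ (-1), κ⟩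
            * (GaugeField.gaugeAct σ U ⟨Function.update z μ (-1), μ⟩)⁻¹
            * (GaugeField.gaugeAct σ U ⟨Function.update z κ (-1), κ⟩)⁻¹)
          ≤ δ + 2 * (((P.sitesPerDir j - 1 : ℕ) : ℝ)
              * (δ + 2 * (((P.d - 1 : ℕ) : ℝ) * ((P.sitesPerDir j - 1 : ℕ) : ℝ) * δ)))) := by
  have hN0 : P.sitesPerDir j ≠ 0 := P.sitesPerDir_ne_zero j
  set hi : Fin P.d → ℤ := fun _ => (P.sitesPerDir j : ℤ) - 1 with hhi
  have hV : PlaqSmall δ (GaugeField.gaugeAct (axialGauge U 0 hi) U) := (plaqSmall_gaugeAct_iff δ _ U).mpr hU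
  have hax : ∀ b : PBond P j, b.src b.dir ≠ -1 →
      dist1 (GaugeField.gaugeAct (axialGauge U 0 hi) U b) ≤ ((P.d - 1 : ℕ) : ℝ) * ((P.sitesPerDir j - 1 : ℕ) : ℝ) * δ := by
    intro b hb
    have hS₀ : boxPlaqs (0 : Fin P.d → ℤ) hi ⊆ (Set.univ : Set (Plaq P j)) := Set.subset_univ _
    have hU' : PlaqSmallOn (Set.univ : Set (Plaq P j)) δ U := fun p _ => hU p
    have hn : ∀ κ, hi κ ≤ (0 : Fin P.d → ℤ) κ + ((P.sitesPerDir j - 1 : ℕ) : ℤ) := fun κ => by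
      simp only [hhi, Pi.zero_apply, zero_add]
      omega
    have hnN : P.sitesPerDir j - 1 < P.sitesPerDir j := Nat.sub_one_lt hN0
    exact dist1_gaugeAct_axialGauge_le_of_mem_boxBonds U hS₀ hU' hδ hn hnN (mem_boxBonds_of_ne_neg_one b hb)
  have ha : 0 ≤ ((P.d - 1 : ℕ) : ℝ) * ((P.sitesPerDir j - 1 : ℕ) : ℝ) * δ := by positivity
  exact ⟨axialGauge U 0 hi, hV, hax, fun μ x y hxy => dist1_parallel hV hax hδ ha μ x y hxy,
    fun μ κ hμκ z hzμ hzκ => dist1_commutator_wrap hV hax hμκ z hzμ hzκ⟩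

end Summit.QuantumFields.YangMills.Theorems.TorusWrapHolonomies
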